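import Literature.NumberTheory.IwasawaTheory.ClassicalMuInvariantOnePrimeProofs
import Literature.NumberTheory.IwasawaTheory.ZpExtensionLayerTotallyRamifiedPrime
import Literature.NumberTheory.NumberFields.ClassGroupNormKernelOneRamifiedPrime
import Literature.NumberTheory.NumberFields.AmbiguousClassNumberOneRamifiedPrime
import HarnessLib

/-!
# `A_n ≅ A_n`-coinvariants over the base of a `ℤ_p`-tower with one totally ramified prime, at FINITE level:
# `ker(N : Cl(K_n) → Cl(K)) = I_{Gal(K_n/K)} Cl(K_n)`, `Cl(K_n)_{Gal} ≅ Cl(K)` (Washington Prop. 13.22 / Lang Ch. 5 §4 Thm. 4.1 (iii),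
# in the tree's `ZpExtension` currency)

Topic `NumberTheory/IwasawaTheory` (namespace = path).  THEOREM-ONLY file (no definition, no named fact, no `sorry`), written by the prover seat
`bsd-wall-rtt-p4-w2` g20 (cell `bsd-wall`; `--supports` stmt-BirchSwinnertonDyer-21438, line `nonsquare-descent` stub S2; closes nothing; BSD is proved for no
curve here).  It instantiates the number-field theorem
`Literature.NumberTheory.NumberFields.ClassGroupNormKernel.ker_classGroupNorm_eq_closure_of_ramificationIdx_eq_finrank` (Washington §13.3 L.13.15,
Prop. 13.22 at finite level) at the base pair `K ⊆ K_n` of a `ℤ_p`-extension `κ` of a number field `K`, with the layer lemmas of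
`ClassicalMuInvariantOnePrimeProofs.lean`: `K_n/K` is Galois of degree `pⁿ` (`ZpExtension.isGalois_layer_holds`, `finrank_layer_holds`), unramified at the
infinite places (`isUnramifiedAtInfinitePlaces_layer`, every `p`) and at every prime not above `p` (`isUnramifiedAt_layer_of_natCast_not_mem_under`).

HYPOTHESIS (Lang's «IW with one prime» read at level `n`; Washington Prop. 13.22's «exactly one prime is ramified, and assume it is totally ramified»):
`𝔓` is a prime of `K_n` with `e(𝔓 | K) = pⁿ`, and `𝔓` is the ONLY prime of `K_n` above `p`.

* **`ker_classGroupNorm_layer_eq_closure`** — `ker (N_{K_n/K} : Cl(K_n) → Cl(K)) = I_{Gal(K_n/K)} · Cl(K_n)` (the subgroup generated by the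
  classes `τ c / c`);
* `exists_quotient_closure_layer_mulEquiv` — `Cl(K_n) ⧸ I · Cl(K_n) ≃* Cl(K)` through the norm; `card_closure_layer_mul_card` — `#I·Cl(K_n) · h_K = h(K_n)`;
* `card_fixed_layer_eq_classNumber` — for a generator `σ` of `Gal(K_n/K)`: `#Cl(K_n)^{Gal} = h_K`; `unitsE_layer_le_norm` — every unit of `K` is a norm
  from `K_nˣ` (via `AmbiguousClassNumberOneRamifiedPrime.lean`).

* **`exists_ramificationIdx_eq_pow_of_totallyRamifiedFrom_zero`**, **`ker_classGroupNorm_layer_eq_closure_of_totallyRamifiedFrom_zero`**,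
  `card_closure_layer_mul_card_of_totallyRamifiedFrom_zero` — the hypothesis DISCHARGED from tree data: `TotallyRamifiedFrom κ 0` (Fukuda index `0`) and
  «`K` has exactly one prime above `p`» give, at every level `n`, the totally ramified prime and its uniqueness (Washington Lemma 13.3 / Prop. 13.2).

Between two layers `K_k ⊆ K_j` the same follows from `OneRamifiedPrimeTower.lean` once `K_k` is realised as an intermediate field of `K_j`
(`IntermediateField.restrict`, as in `Fukuda1994Thm1Proofs`).

References: [Washington1997] §13.3 Lemmas 13.14–13.15, Prop. 13.22; §13.1 Prop. 13.2; [Lang1990] Ch. 5 §4 Thm. 4.1 (iii) and Corollary (held, PDF p. 104);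
[Greenberg2001IwasawaPastPresent] Prop. 2.1 (the case `A_0 = 0`).
-/

noncomputable section

open scoped NumberField
open NumberField IsDedekindDomain Field Ideal

namespace Literature.NumberTheory.IwasawaTheory

open Literature.NumberTheory.EllipticCurves Literature.NumberTheory.NumberFields
  Literature.NumberTheory.NumberFields.ClassGroupNormKernel
  Literature.NumberTheory.GaloisRepresentations Literature.NumberTheory.GaloisRepresentations.MinkowskiUnit
  Literature.NumberTheory.GaloisRepresentations.CyclicNormIndex

variable {K : Type} [Field K] [NumberField K] {p : ℕ} [hp : Fact p.Prime] (κ : ZpExtension K p) (n : ℕ)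

/-- The uniqueness hypothesis of `ClassGroupNormKernel` from «`𝔓` is the only prime of `K_n` above `p`»: a prime of `K_n` ramified over `K` lies above `p`
(`ZpExtension.isUnramifiedAt_layer_of_natCast_not_mem_under`, Washington Prop. 13.2), hence is `𝔓`. [cite: Washington1997, §13.1 Prop. 13.2] -/
theorem eq_of_ramificationIdx_layer_ne_one [NumberField (κ.layer n)] (𝔓 : Ideal (𝓞 (κ.layer n)))
    (huniq : ∀ (Q : Ideal (𝓞 (κ.layer n))) [Q.IsMaximal], ((p : ℕ) : 𝓞 K) ∈ Q.under (𝓞 K) → Q = 𝔓)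
    (Q : Ideal (𝓞 (κ.layer n))) [Q.IsMaximal] (hQ : Q.ramificationIdx (𝓞 K) ≠ 1) : Q = 𝔓 := by
  refine huniq Q ?_
  by_contra hmem
  haveI := κ.isUnramifiedAt_layer_of_natCast_not_mem_under n Q hmem
  exact hQ (Ideal.ramificationIdx_eq_one Q (𝓞 K))

/-- **`ker N_{K_n/K} = I_{Gal(K_n/K)} · Cl(K_n)` (Washington Prop. 13.22 / Lang Ch. 5 §4 Thm. 4.1 (iii) at finite level).**  `κ` a `ℤ_p`-extension of
the number field `K`, `𝔓` a prime of `K_n = κ.layer n` with `e(𝔓 | K) = pⁿ` which is the only prime of `K_n` above `p`: the kernel of the norm on class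
groups is the subgroup generated by the classes `τ c / c`, `τ ∈ Gal(K_n/K)`.
[cite: Washington1997, §13.3 Lemma 13.15 and Prop. 13.22] [cite: Lang1990, Ch. 5 §4 Thm. 4.1 (iii) and Corollary (PDF p. 104)] -/
theorem ker_classGroupNorm_layer_eq_closure [NumberField (κ.layer n)] (𝔓 : Ideal (𝓞 (κ.layer n))) [𝔓.IsMaximal]
    (h𝔓 : 𝔓.ramificationIdx (𝓞 K) = p ^ n)
    (huniq : ∀ (Q : Ideal (𝓞 (κ.layer n))) [Q.IsMaximal], ((p : ℕ) : 𝓞 K) ∈ Q.under (𝓞 K) → Q = 𝔓) :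
    (classGroupNorm K (κ.layer n)).ker = Subgroup.closure {x : ClassGroup (𝓞 (κ.layer n)) |
      ∃ (τ : (κ.layer n) ≃ₐ[K] (κ.layer n)) (d : ClassGroup (𝓞 (κ.layer n))), x = ClassGroup.mulEquiv (AmbiguousClass.intAut τ) d / d} := by
  haveI : FiniteDimensional K (κ.layer n) := κ.finiteDimensional_layer_holds n
  haveI : IsGalois K (κ.layer n) := κ.isGalois_layer_holds n
  haveI : IsUnramifiedAtInfinitePlaces K (κ.layer n) := κ.isUnramifiedAtInfinitePlaces_layer n
  exact ker_classGroupNorm_eq_closure_of_ramificationIdx_eq_finrank 𝔓 (by rw [h𝔓, κ.finrank_layer_holds n])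
    (fun Q _ hQ => eq_of_ramificationIdx_layer_ne_one κ n 𝔓 huniq Q hQ)

/-- **`Cl(K_n)_{Gal(K_n/K)} ≅ Cl(K)`** through the norm, under the same hypotheses (`X/ω₀X ≅ A₀` at finite level). [cite: Washington1997, §13.3 Prop. 13.22]
[cite: Lang1990, Ch. 5 §4 Thm. 4.1 (iii)] -/
theorem exists_quotient_closure_layer_mulEquiv [NumberField (κ.layer n)] (𝔓 : Ideal (𝓞 (κ.layer n))) [𝔓.IsMaximal]
    (h𝔓 : 𝔓.ramificationIdx (𝓞 K) = p ^ n)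
    (huniq : ∀ (Q : Ideal (𝓞 (κ.layer n))) [Q.IsMaximal], ((p : ℕ) : 𝓞 K) ∈ Q.under (𝓞 K) → Q = 𝔓) :
    ∃ e : ClassGroup (𝓞 (κ.layer n)) ⧸ Subgroup.closure {x : ClassGroup (𝓞 (κ.layer n)) |
        ∃ (τ : (κ.layer n) ≃ₐ[K] (κ.layer n)) (d : ClassGroup (𝓞 (κ.layer n))), x = ClassGroup.mulEquiv (AmbiguousClass.intAut τ) d / d} ≃*
        ClassGroup (𝓞 K),
      ∀ c : ClassGroup (𝓞 (κ.layer n)), e c = classGroupNorm K (κ.layer n) c := by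
  haveI : FiniteDimensional K (κ.layer n) := κ.finiteDimensional_layer_holds n
  haveI : IsGalois K (κ.layer n) := κ.isGalois_layer_holds n
  haveI : IsUnramifiedAtInfinitePlaces K (κ.layer n) := κ.isUnramifiedAtInfinitePlaces_layer n
  exact exists_quotient_closure_mulEquiv 𝔓 (by rw [h𝔓, κ.finrank_layer_holds n])
    (fun Q _ hQ => eq_of_ramificationIdx_layer_ne_one κ n 𝔓 huniq Q hQ)

/-- **`#I·Cl(K_n) · h_K = h(K_n)`** under the same hypotheses. [cite: Washington1997, §13.3 Prop. 13.22] [cite: Lang1990, Ch. 5 §4 Thm. 4.1 (iii)] -/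
theorem card_closure_layer_mul_card [NumberField (κ.layer n)] (𝔓 : Ideal (𝓞 (κ.layer n))) [𝔓.IsMaximal]
    (h𝔓 : 𝔓.ramificationIdx (𝓞 K) = p ^ n)
    (huniq : ∀ (Q : Ideal (𝓞 (κ.layer n))) [Q.IsMaximal], ((p : ℕ) : 𝓞 K) ∈ Q.under (𝓞 K) → Q = 𝔓) :
    Nat.card (Subgroup.closure {x : ClassGroup (𝓞 (κ.layer n)) |
        ∃ (τ : (κ.layer n) ≃ₐ[K] (κ.layer n)) (d : ClassGroup (𝓞 (κ.layer n))), x = ClassGroup.mulEquiv (AmbiguousClass.intAut τ) d / d}) *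
      Fintype.card (ClassGroup (𝓞 K)) = Fintype.card (ClassGroup (𝓞 (κ.layer n))) := by
  haveI : FiniteDimensional K (κ.layer n) := κ.finiteDimensional_layer_holds n
  haveI : IsGalois K (κ.layer n) := κ.isGalois_layer_holds n
  haveI : IsUnramifiedAtInfinitePlaces K (κ.layer n) := κ.isUnramifiedAtInfinitePlaces_layer n
  exact card_closure_mul_card_classGroup 𝔓 (by rw [h𝔓, κ.finrank_layer_holds n])
    (fun Q _ hQ => eq_of_ramificationIdx_layer_ne_one κ n 𝔓 huniq Q hQ)

/-- **`#Cl(K_n)^{Gal(K_n/K)} = h_K`** for a generator `σ` of `Gal(K_n/K)` (cyclic), under the same hypotheses (Chevalley's count, `AmbiguousClassNumberOneRamifiedPrime`).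
[cite: Lang1990, Ch. 13 §4 Lemma 4.1 (PDF p. 203) and Ch. 5 §4 Thm. 4.1 (iii)] [cite: Washington1997, §13.3 Prop. 13.22] -/
theorem card_fixed_layer_eq_classNumber [NumberField (κ.layer n)] {σ : (κ.layer n) ≃ₐ[K] (κ.layer n)}
    (hσ : ∀ τ : (κ.layer n) ≃ₐ[K] (κ.layer n), τ ∈ Subgroup.zpowers σ) (𝔓 : Ideal (𝓞 (κ.layer n))) [𝔓.IsMaximal]
    (h𝔓 : 𝔓.ramificationIdx (𝓞 K) = p ^ n)
    (huniq : ∀ (Q : Ideal (𝓞 (κ.layer n))) [Q.IsMaximal], ((p : ℕ) : 𝓞 K) ∈ Q.under (𝓞 K) → Q = 𝔓) :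
    Nat.card {c : ClassGroup (𝓞 (κ.layer n)) // ∀ τ : (κ.layer n) ≃ₐ[K] (κ.layer n), ClassGroup.mulEquiv (AmbiguousClass.intAut τ) c = c} =
      classNumber K := by
  haveI : FiniteDimensional K (κ.layer n) := κ.finiteDimensional_layer_holds n
  haveI : IsGalois K (κ.layer n) := κ.isGalois_layer_holds n
  haveI : IsUnramifiedAtInfinitePlaces K (κ.layer n) := κ.isUnramifiedAtInfinitePlaces_layer n
  exact card_fixed_eq_classNumber hσ 𝔓 (by rw [h𝔓, κ.finrank_layer_holds n])
    (fun Q _ hQ => eq_of_ramificationIdx_layer_ne_one κ n 𝔓 huniq Q hQ)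

/-- **Every unit of `K` is a norm from `K_nˣ`** for a generator `σ` of `Gal(K_n/K)`, under the same hypotheses (`E_K = 𝓞_{K_n}ˣ ∩ Kˣ ≤ N_G(K_nˣ)`).
[cite: Lang1990, Ch. 13 §4 Lemma 4.1 (PDF p. 203)] [cite: Washington1997, §13.3 Prop. 13.22] -/
theorem unitsE_layer_le_norm [NumberField (κ.layer n)] {σ : (κ.layer n) ≃ₐ[K] (κ.layer n)}
    (hσ : ∀ τ : (κ.layer n) ≃ₐ[K] (κ.layer n), τ ∈ Subgroup.zpowers σ) (𝔓 : Ideal (𝓞 (κ.layer n))) [𝔓.IsMaximal]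
    (h𝔓 : 𝔓.ramificationIdx (𝓞 K) = p ^ n)
    (huniq : ∀ (Q : Ideal (𝓞 (κ.layer n))) [Q.IsMaximal], ((p : ℕ) : 𝓞 K) ∈ Q.under (𝓞 K) → Q = 𝔓) :
    unitsE (κ.layer n) ⊓ (unitsIncl K (κ.layer n)).range ≤
      (⊤ : Subgroup (κ.layer n)ˣ).map (Herbrand.norm ((κ.layer n) ≃ₐ[K] (κ.layer n))) := by
  haveI : FiniteDimensional K (κ.layer n) := κ.finiteDimensional_layer_holds n
  haveI : IsGalois K (κ.layer n) := κ.isGalois_layer_holds n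
  haveI : IsUnramifiedAtInfinitePlaces K (κ.layer n) := κ.isUnramifiedAtInfinitePlaces_layer n
  exact unitsE_inf_range_le_map_norm hσ 𝔓 (by rw [h𝔓, κ.finrank_layer_holds n])
    (fun Q _ hQ => eq_of_ramificationIdx_layer_ne_one κ n 𝔓 huniq Q hQ)

/-! ### From Fukuda index `0` and one prime of `K` above `p` -/

omit hp in
/-- In a Galois extension the ramification index of a prime divides the degree. [cite: NeukirchANT1999, Ch. I §9 (9.1) and Ch. II (9.6)] -/
private theorem ramificationIdx_dvd_finrank' {F : Type} [Field F] [NumberField F] [Algebra K F] [IsGalois K F]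
    (Q : Ideal (𝓞 F)) [Q.IsMaximal] : Q.ramificationIdx (𝓞 K) ∣ Module.finrank K F := by
  haveI : (Q.under (𝓞 K)).IsMaximal := Ideal.IsMaximal.under (𝓞 K) Q
  have h := Ideal.ncard_primesOver_mul_ramificationIdxIn_mul_inertiaDegIn (Q.under (𝓞 K)) (𝓞 F) (F ≃ₐ[K] F)
  rw [IsGalois.card_aut_eq_finrank, Ideal.ramificationIdxIn_eq_ramificationIdx (Q.under (𝓞 K)) Q (F ≃ₐ[K] F)] at h
  exact ⟨(Ideal.primesOver (Q.under (𝓞 K)) (𝓞 F)).ncard * (Q.under (𝓞 K)).inertiaDegIn (𝓞 F), by rw [← h]; ring⟩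

/-- **The hypotheses from the tree's `ℤ_p`-tower data.**  If every prime ramified in `K_∞/K` is totally ramified from `K` on (`TotallyRamifiedFrom κ 0`,
Fukuda's index `0`; e.g. the cyclotomic `ℤ_p`-extension of `ℚ`, tree `CyclotomicRatTotallyRamified`, or any tower whose ramified primes ramify in `K₁`,
tree `totallyRamifiedFrom_zero_of_forall_not_isUnramifiedIn_layer_one`) and `K` has exactly ONE prime `v₀` above `p`, then every layer `K_n` has a prime
`𝔓` with `e(𝔓 | K) = pⁿ` which is the only prime of `K_n` above `p` (Washington Lemma 13.3: some prime above `p` ramifies, tree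
`ZpExtension.exists_isMaximal_forall_mem_inertia`; it lies over `v₀`, is totally ramified, hence alone over `v₀`,
`ClassGroupNormKernel.eq_of_under_eq_of_ramificationIdx_eq_finrank`). [cite: Washington1997, §13.1 Lemma 13.3, Prop. 13.2 and §13.3 Prop. 13.22 (hypotheses)] -/
theorem exists_ramificationIdx_eq_pow_of_totallyRamifiedFrom_zero [NumberField (κ.layer n)] (hκ : TotallyRamifiedFrom κ 0)
    (v₀ : HeightOneSpectrum (𝓞 K)) (hv₀ : ∀ w : HeightOneSpectrum (𝓞 K), ((p : ℕ) : 𝓞 K) ∈ w.asIdeal → w = v₀) :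
    ∃ (𝔓 : Ideal (𝓞 (κ.layer n))) (_ : 𝔓.IsMaximal), 𝔓.ramificationIdx (𝓞 K) = p ^ n ∧
      ∀ (Q : Ideal (𝓞 (κ.layer n))) [Q.IsMaximal], ((p : ℕ) : 𝓞 K) ∈ Q.under (𝓞 K) → Q = 𝔓 := by
  classical
  haveI : FiniteDimensional K (κ.layer n) := κ.finiteDimensional_layer_holds n
  haveI : IsGalois K (κ.layer n) := κ.isGalois_layer_holds n
  have hpr : p.Prime := Fact.out
  -- the contraction of a prime of `K_n` containing `p` is `v₀`
  have hunder : ∀ (Q : Ideal (𝓞 (κ.layer n))) [Q.IsMaximal], ((p : ℕ) : 𝓞 K) ∈ Q.under (𝓞 K) → Q.under (𝓞 K) = v₀.asIdeal := by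
    intro Q _ hpQ
    have hQ0 : Q ≠ ⊥ := Ring.ne_bot_of_isMaximal_of_not_isField ‹_› (RingOfIntegers.not_isField (κ.layer n))
    have h0 : Q.under (𝓞 K) ≠ ⊥ := mt Ideal.eq_bot_of_comap_eq_bot hQ0
    haveI : (Q.under (𝓞 K)).IsMaximal := Ideal.IsMaximal.under (𝓞 K) Q
    have hw := hv₀ ⟨Q.under (𝓞 K), Ideal.IsMaximal.isPrime ‹_›, h0⟩ hpQ
    exact congrArg HeightOneSpectrum.asIdeal hw
  -- a prime `𝔓` of `K_n` over `v₀` with `e(𝔓 | K) = pⁿ`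
  obtain ⟨𝔓, h𝔓max, h𝔓e, h𝔓v⟩ : ∃ (𝔓 : Ideal (𝓞 (κ.layer n))), 𝔓.IsMaximal ∧ 𝔓.ramificationIdx (𝓞 K) = p ^ n ∧
      𝔓.under (𝓞 K) = v₀.asIdeal := by
    rcases Nat.eq_zero_or_pos n with hn0 | hnpos
    · -- `n = 0`: any prime over `v₀`; `e ∣ [K_0 : K] = 1`
      subst hn0
      haveI : v₀.asIdeal.IsMaximal := v₀.isMaximal
      obtain ⟨Q, hQmax, hQv⟩ := Ideal.exists_maximal_ideal_liesOver_of_isIntegral (S := 𝓞 (κ.layer 0)) v₀.asIdeal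
      haveI := hQmax
      refine ⟨Q, hQmax, ?_, hQv.over.symm⟩
      have hdvd := ramificationIdx_dvd_finrank' (K := K) Q
      rw [κ.finrank_layer_holds 0, pow_zero, Nat.dvd_one] at hdvd
      rw [hdvd, pow_zero]
    · obtain ⟨Q, hQmax, hQI⟩ := κ.exists_isMaximal_forall_mem_inertia (n₀ := 0) (n := 0) (m := n) hκ le_rfl (Nat.zero_le n) hnpos
      haveI := hQmax
      -- `I(Q) = Gal(K_n/K)`, so `e(Q | K) = pⁿ`
      have htop : Q.inertia ((κ.layer n) ≃ₐ[K] (κ.layer n)) = ⊤ := by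
        rw [eq_top_iff]
        intro g _
        refine hQI g fun x hx => ?_
        rw [κ.layer_zero, IntermediateField.mem_bot] at hx
        obtain ⟨y, hy⟩ := hx
        have hxy : x = algebraMap K (κ.layer n) y := Subtype.ext hy.symm
        rw [hxy, AlgEquiv.commutes]
      have he : Q.ramificationIdx (𝓞 K) = p ^ n := by
        rw [← card_inertia_eq_ramificationIdx (κ.layer n) ((κ.layer n) ≃ₐ[K] (κ.layer n)) K Q, htop, Subgroup.card_top,
          IsGalois.card_aut_eq_finrank, κ.finrank_layer_holds n]
      refine ⟨Q, hQmax, he, hunder Q ?_⟩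
      -- `Q` is ramified (`e = pⁿ ≠ 1`), so it lies above `p`
      by_contra hmem
      haveI := κ.isUnramifiedAt_layer_of_natCast_not_mem_under n Q hmem
      have h1 : Q.ramificationIdx (𝓞 K) = 1 := Ideal.ramificationIdx_eq_one Q (𝓞 K)
      rw [he] at h1
      exact (Nat.one_lt_pow hnpos.ne' hpr.one_lt).ne' h1
  haveI := h𝔓max
  refine ⟨𝔓, h𝔓max, h𝔓e, fun Q _ hpQ => ?_⟩
  exact eq_of_under_eq_of_ramificationIdx_eq_finrank 𝔓 (by rw [h𝔓e, κ.finrank_layer_holds n]) Q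
    ((hunder Q hpQ).trans h𝔓v.symm)

/-- **`ker N_{K_n/K} = I_{Gal(K_n/K)} · Cl(K_n)` for every layer of a `ℤ_p`-extension with Fukuda index `0` over a field with ONE prime above `p`**
(Lang's «IW with one prime», Ch. 5 §4 Thm. 4.1 (iii) and Corollary, at finite level; Washington Prop. 13.22 `A_0 ≅ X/TX` read at level `n`).
[cite: Lang1990, Ch. 5 §4 Thm. 4.1 (iii) and Corollary (PDF p. 104)] [cite: Washington1997, §13.3 Prop. 13.22] -/
theorem ker_classGroupNorm_layer_eq_closure_of_totallyRamifiedFrom_zero [NumberField (κ.layer n)] (hκ : TotallyRamifiedFrom κ 0)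
    (v₀ : HeightOneSpectrum (𝓞 K)) (hv₀ : ∀ w : HeightOneSpectrum (𝓞 K), ((p : ℕ) : 𝓞 K) ∈ w.asIdeal → w = v₀) :
    (classGroupNorm K (κ.layer n)).ker = Subgroup.closure {x : ClassGroup (𝓞 (κ.layer n)) |
      ∃ (τ : (κ.layer n) ≃ₐ[K] (κ.layer n)) (d : ClassGroup (𝓞 (κ.layer n))), x = ClassGroup.mulEquiv (AmbiguousClass.intAut τ) d / d} := by
  obtain ⟨𝔓, h𝔓max, h𝔓, huniq⟩ := exists_ramificationIdx_eq_pow_of_totallyRamifiedFrom_zero κ n hκ v₀ hv₀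
  exact ker_classGroupNorm_layer_eq_closure κ n 𝔓 h𝔓 huniq

/-- **`Cl(K_n)_{Gal(K_n/K)} ≅ Cl(K)` and `#I·Cl(K_n) · h_K = h(K_n)`** under the same tower hypotheses. [cite: Lang1990, Ch. 5 §4 Thm. 4.1 (iii)]
[cite: Washington1997, §13.3 Prop. 13.22] -/
theorem card_closure_layer_mul_card_of_totallyRamifiedFrom_zero [NumberField (κ.layer n)] (hκ : TotallyRamifiedFrom κ 0)
    (v₀ : HeightOneSpectrum (𝓞 K)) (hv₀ : ∀ w : HeightOneSpectrum (𝓞 K), ((p : ℕ) : 𝓞 K) ∈ w.asIdeal → w = v₀) :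
    Nat.card (Subgroup.closure {x : ClassGroup (𝓞 (κ.layer n)) |
        ∃ (τ : (κ.layer n) ≃ₐ[K] (κ.layer n)) (d : ClassGroup (𝓞 (κ.layer n))), x = ClassGroup.mulEquiv (AmbiguousClass.intAut τ) d / d}) *
      Fintype.card (ClassGroup (𝓞 K)) = Fintype.card (ClassGroup (𝓞 (κ.layer n))) := by
  obtain ⟨𝔓, h𝔓max, h𝔓, huniq⟩ := exists_ramificationIdx_eq_pow_of_totallyRamifiedFrom_zero κ n hκ v₀ hv₀
  exact card_closure_layer_mul_card κ n 𝔓 h𝔓 huniq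

end Literature.NumberTheory.IwasawaTheory

end
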